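import Mathlib.AlgebraicGeometry.Morphisms.ClosedImmersion
import Mathlib.AlgebraicGeometry.IdealSheaf.Subscheme
import Mathlib.RingTheory.GradedAlgebra.Homogeneous.Ideal
import HarnessLib

/-!
# Route `WeightedInvariant` — definitions posited by the proof of crux `DatumToEmbedded`

Route `ResolutionOfSingularities/WeightedInvariant`, crux `DatumToEmbedded`
(stmt-ResolutionOfSingularities-0572), line `Sketch` (lead a2, 2026-08-16): the bookkeeping
structure of the torus-quotient half of the proof (the route file's "NOT DECOMPOSED YET … to be
filed when the prover's P2 definitions (torus action, good quotient) land").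

* `GradedAtlas j f i q` — a **torus-quotient presentation of rank `j`** of the closed subscheme
  `i : X ⟶ Y` (over `f : Y ⟶ Spec k`) by the morphism `q : X ⟶ V`, in the GRADED ENCODING of a
  `𝔾ₘʲ`-action (Włodarczyk, arXiv:2203.03090, §2.3.1: a good quotient is an affine `T`-invariant
  `π : X → X⫽T` with `𝒪_{X⫽T} ≃ π_*(𝒪_X)^T`, geometric when the geometric fibres are single orbits;
  for the split torus `T = 𝔾ₘʲ = Spec k[ℤʲ]` acting on an affine `Spec A`, the action is a
  `ℤʲ`-grading of `A` over `k`, the invariants are the degree-`0` part, and "finite stabilisers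
  with closed orbits" is the existence, near every point, of homogeneous units of all degrees in a
  subgroup of finite index): finitely many affine charts `W a ⊆ Y`, `U a ⊆ V` with
  `X ∩ W a = q⁻¹(U a)`, `ℤʲ`-gradings of the `Γ(Y, W a)` with the constants in degree `0` and the
  ideal of `X` homogeneous, `q♯ : Γ(V, U a) → Γ(X, X ∩ W a)` injective with image the classes of
  the degree-`0` sections, and a uniform exponent `e ≥ 1` with homogeneous units of all degrees in
  `e·ℤʲ` near every point. Rank `0` is the trivial presentation `q = 𝟙 X`; the cobordant blow-up
  of a `𝔾ₘʲ`-presented pair is `𝔾ₘ^{j+1}`-presented over the blow-up of `V` along the invariant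
  part of a Veronese piece of the centre (crux file, `stub_quotientStep`).

No theorem here; the structure is consumed by `Theorems/WeightedInvariantDatumToEmbedded*.lean`.
-/

noncomputable section

open CategoryTheory AlgebraicGeometry TopologicalSpace

set_option linter.dupNamespace false -- mandated namespace of this single-conjunct summit

namespace Summit.ResolutionOfSingularities.ResolutionOfSingularities.Theorems

/-- A **graded atlas of rank `j`** for the closed immersion `i : X ⟶ Y` over `f : Y ⟶ Spec k`
and the morphism `q : X ⟶ V`: the data exhibiting `q` as the good geometric quotient of `X` by a
`𝔾ₘʲ`-action induced from `𝔾ₘʲ`-stable affine charts of the ambient `Y` (Włodarczyk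
arXiv:2203.03090 §2.3.1: "A good (GIT) quotient is an affine `T`-invariant morphism
`π : X → Y = X⫽T` such that `𝒪_Y ≃ π_*(𝒪_X)^T`. The quotient is geometric if all geometric fibers
of `π` are single `T`-orbits"; a `𝔾ₘʲ = Spec k[ℤʲ]`-action on an affine `Spec A` is a
`ℤʲ`-grading of `A` over `k`, invariants are the degree-`0` part, and "finite stabilisers with
closed orbits" is the existence of homogeneous units of all degrees in a finite-index subgroup).
Fields: affine charts `U a ⊆ V` covering `V` and `W a ⊆ Y` with `X ∩ W a = q⁻¹(U a)`; a
`ℤʲ`-grading of `Γ(Y, W a)` containing the constants in degree `0`, for which the ideal of `X` is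
homogeneous; `q♯` maps `Γ(V, U a)` bijectively onto the classes of the degree-`0` sections; a
uniform exponent `e ≥ 1` such that near every point of `X` some chart carries homogeneous sections
of every degree in `e·ℤʲ` that are units on `X`. -/
structure GradedAtlas (j : ℕ) {k : Type} [Field k] {Y X V : Scheme.{0}}
    (f : Y ⟶ Spec (.of k)) (i : X ⟶ Y) [IsClosedImmersion i] (q : X ⟶ V) : Type 1 where
  /-- index set of the charts (finite) -/
  ι : Type
  /-- finitely many charts -/
  finite_ι : Finite ι
  /-- the charts of the quotient -/
  U : ι → V.affineOpens
  /-- they cover `V` -/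
  iSup_eq_top : ⨆ a, (U a : V.Opens) = ⊤
  /-- the ambient charts -/
  W : ι → Y.affineOpens
  /-- `X ∩ W a = q⁻¹ (U a)` -/
  preimage_eq : ∀ a, i ⁻¹ᵁ (W a : Y.Opens) = q ⁻¹ᵁ (U a : V.Opens)
  /-- the `ℤʲ`-grading of the ambient chart ring (characters of `𝔾ₘʲ`) -/
  piece : ∀ a, (Fin j → ℤ) → AddSubgroup Γ(Y, W a)
  /-- it is a grading -/
  gradedRing : ∀ a, GradedRing (piece a)
  /-- constants have degree `0` -/
  appLE_mem : ∀ a (c : Γ(Spec (.of k), ⊤)), f.appLE ⊤ (W a) le_top c ∈ piece a 0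
  /-- the ideal of `X` on the chart is homogeneous -/
  isHomogeneous_ker : ∀ a, letI := gradedRing a; (i.ker.ideal (W a)).IsHomogeneous (piece a)
  /-- every degree-`0` section of the chart descends to `V` … -/
  exists_preimage : ∀ a (s : Γ(Y, W a)), s ∈ piece a 0 →
    ∃ c : Γ(V, U a), q.appLE (U a) (i ⁻¹ᵁ (W a)) (preimage_eq a).le c = i.app (W a) s
  /-- … every section of `V` over `U a` is the class of a degree-`0` section … -/
  exists_lift : ∀ a (c : Γ(V, U a)), ∃ s ∈ piece a 0,
    q.appLE (U a) (i ⁻¹ᵁ (W a)) (preimage_eq a).le c = i.app (W a) s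
  /-- … and `q♯` is injective -/
  appLE_injective : ∀ a, Function.Injective (q.appLE (U a) (i ⁻¹ᵁ (W a)) (preimage_eq a).le)
  /-- the uniform exponent -/
  exponent : ℕ
  /-- it is positive -/
  exponent_pos : 0 < exponent
  /-- homogeneous units of all degrees in `e·ℤʲ` near every point (finite stabilisers, closed
  orbits) -/
  exists_unit : ∀ x : X, ∃ a, i x ∈ (W a : Y.Opens) ∧
    ∀ χ : Fin j → ℤ, ∃ s ∈ piece a (exponent • χ), IsUnit (i.app (W a) s)

end Summit.ResolutionOfSingularities.ResolutionOfSingularities.Theorems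

end
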